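import Summits.NavierStokesRegularity.FluidComputer.RowPhaseSegment
import Summits.NavierStokesRegularity.FluidComputer.RowChainStages
import Summits.NavierStokesRegularity.FluidComputer.RowSwitchRoot
import Summits.NavierStokesRegularity.FluidComputer.RowChainP
import HarnessLib

/-!
# The row model, part 8: THE PHASE MAPS EXIST ALONG THE WHOLE k53d CHAIN (layer A′ global;
# `pub-fluidc-bp3/R1-DESIGN.md` §11.7 (G-e), chain level)

HONEST FRAMING (cell `pub-fluidc`, blueprint seat bp3, gen 22): low prior, high value-of-information
experiment on Tao's machine paradigm; NOT a claim that NS blows up.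

WHAT. `RowChain.segAD` (the certified enclosures on all 1066 rows) ASSUMES three member data
`mA, mB, mD` (one per lock coordinate), a `MemberOn` record on every row and the two `StageOn`
records at the stage switches `656|657`, `986|987`. `chain_members` CONSTRUCTS all of that for ONE
trajectory `(y, δF, D)` from phase-INDEPENDENT hypotheses: the ODE with defect on the open domain
`D`, per row the continuity of the phase speed and the TUBE defect class, the maximal-domain
property, at each of the two stage switches the WINDOW hypotheses (window in `D`, window defect
class) for every phase whose state is within the old row's end tube of the new reference start, and
the start data `σ₀ ∈ D`, `y_1(σ₀) = x̂_1(0)`, start box. So: for every such trajectory there EXIST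
phase maps under which `segAD`'s conclusions hold (corollary left to the caller: `segAD` with
`(hmem k hk).some`, `S1.some`, `S2.some`).
PROOF. Segment A (rows `0–656`) by `segment_members`; at `656|657` the old member's end deviation is
within `Ē`, so (`hW1`) the window lies in `D` and `RowData.window_root` re-locks: a phase `ξ₁`
in the window with `y_2(ξ₁) = x̂'_2(0)`; the constant pair at `ξ₁` is a member of row `657` at its
start time, so `switchStage_sound` gives row `657`'s start box (`switch_relock`); segment B (rows
`657–973`) by `segment_members` from `ξ₁`; at the equal-phase switch `973|974` the phase is kept
(`p`, reference continuous; start box by `switchEq_hu0`: `switchEq_relock`); segment C (rows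
`974–986`); B and C glued at `T 974` into `mB`; at `986|987` as at `656|657`; segment D (rows
`987–1065`). Lock coordinates along segments: `RowChain.p_const`.

[cite: Tao2016AveragedNS, §5.5 Thm 5.3 (5.5)]
-/

namespace Summit.NavierStokesRegularity.FluidComputer

open Literature.Analysis.FluidPDE.FluidComputer

namespace RowCheck

open DIVec ChainField Finset Real Set Matrix

namespace RowData

variable {r r' : RowData} {c : SwCert}

/-- **The constant phase pair at a locked phase is a member at the start time.** [folklore] -/
def memberOn_start (Fr : r.Frames) (G : r.GateOK) (T0 : ℝ) {y δF : ℝ → Fin 9 → ℝ} {D : Set ℝ}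
    {σ : ℝ} (hy : ∀ ξ ∈ D, ∀ a, HasDerivAt (fun τ => y τ a) (F G.g G.Λ (y ξ) a + δF ξ a) ξ)
    (hσ : σ ∈ D) (hlock : y σ r.p = xh r.CQ 0 r.p)
    (hδ : (∀ a, |y σ a - xh r.CQ 0 a| ≤ r.EbarR a) → ∀ a, |δF σ a| ≤ r.δR a) :
    (toModel Fr G T0 ⟨y, δF, D, fun _ => σ, fun _ => 0⟩).MemberOn T0 where
  hy := hy
  hsc := continuousOn_const
  hsd := fun t ht => absurd ht.2 (not_lt.mpr ht.1)
  hsD := fun _ _ => hσ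
  hlock := fun t ht => by
    have h : t = T0 := le_antisymm ht.2 ht.1
    show y σ r.p = xh r.CQ (t - T0) r.p
    rw [h, sub_self]
    exact hlock
  hδ := fun t ht hE a => by
    have h : t = T0 := le_antisymm ht.2 ht.1
    refine hδ (fun b => ?_) a
    have h1 := hE b
    change |y σ b - xh r.CQ (t - T0) b| ≤ r.EbarR b at h1
    rwa [h, sub_self] at h1

/-- Start boxes only read the phase at the start time. [folklore] -/
theorem z_start_eq (Fr : r.Frames) (G : r.GateOK) (T0 : ℝ) (y δF : ℝ → Fin 9 → ℝ) (D : Set ℝ)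
    {s sd s' sd' : ℝ → ℝ} (h : s T0 = s' T0) :
    (toModel Fr G T0 ⟨y, δF, D, s, sd⟩).z T0 = (toModel Fr G T0 ⟨y, δF, D, s', sd'⟩).z T0 := by
  simp only [RowModel.z]
  congr 1
  funext a
  show y (s T0) a - _ = y (s' T0) a - _
  rw [h]
  rfl

/-- Reference continuity in every coordinate, from the polynomial identity. [folklore] -/
theorem xh_cont (hx : ∀ a : Fin 9, evalQ (r'.CQ a) 0 = evalQ (r.CQ a) r.Hq) (a : Fin 9) :
    xh r'.CQ 0 a = xh r.CQ r.Hq a := by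
  rw [show (0 : ℝ) = ((0 : ℚ) : ℝ) by simp, xh_ratCast, xh_ratCast, hx a]

/-- **Re-locking at a stage switch.** From the old row's member up to the switch time and its start
box, the phase-independent WINDOW hypotheses and the new row's tube defect class at its start: a
phase `ξ` in the switch window locking the NEW coordinate, the window facts, and the new row's
start box for the constant pair at `ξ`. [folklore] -/
theorem switch_relock (hs : swStageOK r r' c = true) (h : r.framesOK = true) (hl : r.lockOK = true)
    (h' : r'.framesOK = true) (G : r.GateOK) (G' : r'.GateOK) (hg : G'.g = G.g) (hΛ : G'.Λ = G.Λ)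
    (T0 : ℝ) (m : MemberData) (hok : r.rowPass = true) (henc : r.encOK = true)
    (hmem : (toModel (canon h) G T0 m).MemberOn (T0 + r.Hq))
    (hu0 : ∀ i, |(toModel (canon h) G T0 m).z T0 i| ≤ r.ubR 0 i)
    (hW : ∀ σ ∈ m.D, (∀ a, |m.y σ a - r'.X0R a| ≤ (r.Eb a : ℝ) / 2 ^ r'.P) →
      Icc (σ - (c.Ds : ℝ) / 2 ^ r'.P) (σ + (c.Ds : ℝ) / 2 ^ r'.P) ⊆ m.D ∧
      ∀ ξ ∈ Icc (σ - (c.Ds : ℝ) / 2 ^ r'.P) (σ + (c.Ds : ℝ) / 2 ^ r'.P), ∀ a,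
        |m.δF ξ a| ≤ ((max (r.DEL a) (r'.DEL a) : ℤ) : ℝ) / 2 ^ r'.P)
    (htube' : ∀ σ ∈ m.D, (∀ a, |m.y σ a - xh r'.CQ 0 a| ≤ r'.EbarR a) →
      ∀ a, |m.δF σ a| ≤ r'.δR a) :
    ∃ ξ : ℝ, ξ ∈ m.D ∧ m.y ξ r'.p = xh r'.CQ 0 r'.p ∧
      |ξ - m.s (T0 + r.Hq)| ≤ (c.Ds : ℝ) / 2 ^ r'.P ∧
      Icc (m.s (T0 + r.Hq) - (c.Ds : ℝ) / 2 ^ r'.P) (m.s (T0 + r.Hq) + (c.Ds : ℝ) / 2 ^ r'.P)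
        ⊆ m.D ∧
      (∀ ξ' ∈ Icc (m.s (T0 + r.Hq) - (c.Ds : ℝ) / 2 ^ r'.P)
          (m.s (T0 + r.Hq) + (c.Ds : ℝ) / 2 ^ r'.P),
        ∀ a, |m.δF ξ' a| ≤ ((max (r.DEL a) (r'.DEL a) : ℤ) : ℝ) / 2 ^ r'.P) ∧
      ∀ i, |(toModel (canon h') G' (T0 + r.Hq) ⟨m.y, m.δF, m.D, fun _ => ξ, fun _ => 0⟩).z
        (T0 + r.Hq) i| ≤ r'.ubR 0 i := by
  obtain ⟨hP, hx, -, -⟩ := swStageOK_parts hs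
  set T := T0 + r.Hq with hT
  set R := toModel (canon h) G T0 m with hR
  have hH0 : (0 : ℝ) < r.Hq := Hq_pos hok
  obtain ⟨h1, -, -, -⟩ :=
    row_sound (canon h) G T0 m hok henc (canon_hrow h hl) hmem (by linarith) le_rfl hu0
  have he : ∀ a, |R.e T a| ≤ r.EbarR a := h1 T ⟨by linarith, le_rfl⟩
  have hee : ∀ a, m.y (m.s T) a - r'.X0R a = R.e T a := by
    intro a
    simp only [hR, RowModel.e, toModel, hT, add_sub_cancel_left, X0R]
    rw [xh_ratCast, ← hx a, evalQ_zero]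
  have he' : ∀ a, |m.y (m.s T) a - r'.X0R a| ≤ (r.Eb a : ℝ) / 2 ^ r'.P := by
    intro a; rw [hee a, hP]; exact he a
  have hT0 : (toModel (canon h) G T0 m).T₀ ≤ T := by change T0 ≤ T; linarith
  have hσD : m.s T ∈ m.D := hmem.hsD T ⟨hT0, le_rfl⟩
  obtain ⟨hWD, hδw⟩ := hW (m.s T) hσD he'
  have hyD : ∀ ξ ∈ m.D, ∀ a,
      HasDerivAt (fun τ => m.y τ a) (F G'.g G'.Λ (m.y ξ) a + m.δF ξ a) ξ := by
    intro ξ hξ a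
    rw [hg, hΛ]
    exact hmem.hy ξ hξ a
  obtain ⟨ξ, hξW, hroot⟩ := window_root (swStageOK_win hs) G' hWD hyD hδw he'
  have hξD : ξ ∈ m.D := hWD hξW
  have hlock' : m.y ξ r'.p = xh r'.CQ 0 r'.p := by
    rw [xh_zero]
    exact hroot
  have hσ : |ξ - m.s T| ≤ (c.Ds : ℝ) / 2 ^ r'.P := by
    obtain ⟨h1, h2⟩ := hξW
    exact abs_le.mpr ⟨by linarith, by linarith⟩
  have hmem' : (toModel (canon h') G' T ⟨m.y, m.δF, m.D, fun _ => ξ, fun _ => 0⟩).MemberOn T :=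
    memberOn_start (canon h') G' T hyD hξD hlock' (htube' ξ hξD)
  have hz := switchStage_sound hs h hl h' G G' hg hΛ T0 m ⟨m.y, m.δF, m.D, fun _ => ξ, fun _ => 0⟩
    rfl hok henc hmem hu0 le_rfl hmem' hWD hδw hσ
  exact ⟨ξ, hξD, hlock', hσ, hWD, hδw, hz⟩

/-- **Keeping the phase at an equal-phase switch** (same lock coordinate, reference continuous, new
polynomial): the old phase at the switch time locks the new row; start box by `switchEq_hu0`.
[folklore] -/
theorem switchEq_relock (hs : swEqOK r r' = true) (h : r.framesOK = true) (hl : r.lockOK = true)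
    (h' : r'.framesOK = true) (G : r.GateOK) (G' : r'.GateOK) (T0 : ℝ) (m : MemberData)
    (hok : r.rowPass = true) (henc : r.encOK = true)
    (hmem : (toModel (canon h) G T0 m).MemberOn (T0 + r.Hq))
    (hu0 : ∀ i, |(toModel (canon h) G T0 m).z T0 i| ≤ r.ubR 0 i) :
    m.s (T0 + r.Hq) ∈ m.D ∧ m.y (m.s (T0 + r.Hq)) r'.p = xh r'.CQ 0 r'.p ∧
      ∀ i, |(toModel (canon h') G' (T0 + r.Hq) m).z (T0 + r.Hq) i| ≤ r'.ubR 0 i := by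
  obtain ⟨-, hp, hx, -⟩ := swEqOK_iff.mp hs
  have hH0 : (0 : ℝ) < r.Hq := Hq_pos hok
  obtain ⟨h1, -, -, -⟩ :=
    row_sound (canon h) G T0 m hok henc (canon_hrow h hl) hmem (by linarith) le_rfl hu0
  have he := h1 (T0 + r.Hq) ⟨by linarith, le_rfl⟩
  have hz := row_end (canon h) G T0 m hok henc (canon_hrow h hl) hmem hu0
  have hT0 : (toModel (canon h) G T0 m).T₀ ≤ T0 + r.Hq := by change T0 ≤ T0 + r.Hq; linarith
  refine ⟨hmem.hsD _ ⟨hT0, le_rfl⟩, ?_, switchEq_hu0 hs h h' G G' T0 m hH0.ne' hz he⟩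
  have hlck := hmem.hlock (T0 + r.Hq) ⟨hT0, le_rfl⟩
  change m.y (m.s (T0 + r.Hq)) r.p = xh r.CQ (T0 + r.Hq - T0) r.p at hlck
  rw [hp, xh_cont hx, hlck, add_sub_cancel_left]

end RowData

end RowCheck

namespace RowChain

open RowCheck RowCheck.RowData RowRun ChainField Set

/-- The gate data of record, by name (so that no two rows are ever compared). [folklore] -/
theorem G_g (k : ℕ) : (G k).g = gK := rfl

/-- [folklore] -/
theorem G_Λ (k : ℕ) : (G k).Λ = ΛK := rfl

/-- The junction times of the chain increase. [folklore] -/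
theorem T_mono (T : ℕ → ℝ) (hT : ∀ k, T (k + 1) = T k + (row k).Hq) : Monotone T :=
  monotone_nat_of_le_succ fun k => by
    rw [hT k]
    exact (lt_add_of_pos_right _ (Hq_pos ((runOK_iff _).mp (runOK_row k)).1)).le

/-- **LAYER A′, GLOBAL: the phase maps exist along the whole k53d chain.** For ONE trajectory
`(y, δF, D)` with layer R's phase-independent hypotheses (ODE with defect on the open `D`, per-row
continuity of the phase speed and tube defect class, maximal-domain property, window hypotheses at
the two stage switches) and the start data at `σ₀`, there are phase pairs for the three lock
coordinates making `segAD`'s hypotheses `hmem`, `S1`, `S2` true. [folklore] -/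
theorem chain_members (T : ℕ → ℝ) (hT : ∀ k, T (k + 1) = T k + (row k).Hq)
    {y δF : ℝ → Fin 9 → ℝ} {D : Set ℝ} (hDo : IsOpen D)
    (hy : ∀ σ ∈ D, ∀ a, HasDerivAt (fun τ => y τ a) (F gK ΛK (y σ) a + δF σ a) σ)
    (hFc : ∀ k < 1066, ContinuousOn (fun σ => F gK ΛK (y σ) (row k).p + δF σ (row k).p) D)
    (htube : ∀ k < 1066, ∀ σ ∈ D, ∀ t ∈ Icc (T k) (T (k + 1)),
      (∀ a, |y σ a - xh (row k).CQ (t - T k) a| ≤ (row k).EbarR a) →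
        ∀ a, |δF σ a| ≤ (row k).δR a)
    (hDmax : ∀ K ⊆ D, (∀ a, ∃ C, ∀ σ ∈ K, |y σ a| ≤ C) → closure K ⊆ D)
    (hW1 : ∀ σ ∈ D, (∀ a, |y σ a - (row 657).X0R a| ≤ ((row 656).Eb a : ℝ) / 2 ^ (row 657).P) →
      Icc (σ - (cert656.Ds : ℝ) / 2 ^ (row 657).P) (σ + (cert656.Ds : ℝ) / 2 ^ (row 657).P) ⊆ D ∧
      ∀ ξ ∈ Icc (σ - (cert656.Ds : ℝ) / 2 ^ (row 657).P) (σ + (cert656.Ds : ℝ) / 2 ^ (row 657).P),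
        ∀ a, |δF ξ a| ≤ ((max ((row 656).DEL a) ((row 657).DEL a) : ℤ) : ℝ) / 2 ^ (row 657).P)
    (hW2 : ∀ σ ∈ D, (∀ a, |y σ a - (row 987).X0R a| ≤ ((row 986).Eb a : ℝ) / 2 ^ (row 987).P) →
      Icc (σ - (cert986.Ds : ℝ) / 2 ^ (row 987).P) (σ + (cert986.Ds : ℝ) / 2 ^ (row 987).P) ⊆ D ∧
      ∀ ξ ∈ Icc (σ - (cert986.Ds : ℝ) / 2 ^ (row 987).P) (σ + (cert986.Ds : ℝ) / 2 ^ (row 987).P),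
        ∀ a, |δF ξ a| ≤ ((max ((row 986).DEL a) ((row 987).DEL a) : ℤ) : ℝ) / 2 ^ (row 987).P)
    {σ₀ : ℝ} (hσ₀ : σ₀ ∈ D) (hlock0 : y σ₀ (row 0).p = xh (row 0).CQ 0 (row 0).p)
    (hu0 : ∀ i, |(toModel (canon (framesOK_row 0)) (G 0) (T 0)
      ⟨y, δF, D, fun _ => σ₀, fun _ => 0⟩).z (T 0) i| ≤ (row 0).ubR 0 i) :
    ∃ sA sdA sB sdB sD sdD : ℝ → ℝ, sA (T 0) = σ₀ ∧
      (∀ k < 1066, Nonempty ((toModel (canon (framesOK_row k)) (G k) (T k)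
        (mOf ⟨y, δF, D, sA, sdA⟩ ⟨y, δF, D, sB, sdB⟩ ⟨y, δF, D, sD, sdD⟩ k)).MemberOn
          (T (k + 1)))) ∧
      Nonempty (StageOn (row 656) (row 657) cert656 ⟨y, δF, D, sA, sdA⟩ ⟨y, δF, D, sB, sdB⟩
        (T 657)) ∧
      Nonempty (StageOn (row 986) (row 987) cert986 ⟨y, δF, D, sB, sdB⟩ ⟨y, δF, D, sD, sdD⟩
        (T 987)) := by
  have hTm := T_mono T hT
  have hT1 : T 657 = T 656 + (row 656).Hq := hT 656
  have hT2 : T 974 = T 973 + (row 973).Hq := hT 973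
  have hT3 : T 987 = T 986 + (row 986).Hq := hT 986
  -- the per-row hypotheses of `segment_members`, at offset `k0`
  have hyk : ∀ k, ∀ σ ∈ D, ∀ a,
      HasDerivAt (fun τ => y τ a) (F (G k).g (G k).Λ (y σ) a + δF σ a) σ := fun k => hy
  have hFck : ∀ k < 1066,
      ContinuousOn (fun σ => F (G k).g (G k).Λ (y σ) (row k).p + δF σ (row k).p) D :=
    fun k hk => hFc k hk
  -- ### segment A: rows 0 … 656
  obtain ⟨sA, sdA, hsA0, hmemA⟩ := segment_members (fun k => row k) (fun k => framesOK_row k)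
    (fun k => G k) T hT 657 (fun k _ => runOK_row k)
    (fun k hk => juncOK_at dflt k (by omega) (not_sw le_rfl (b := 657) hk (by omega)))
    (fun k hk => p_const (by omega) (by omega) (by omega)) hDo (fun k _ => hyk k)
    (fun k hk => hFck k (by omega)) (fun k hk => htube k (by omega)) hDmax hσ₀ hlock0 hu0
  set mA : MemberData := ⟨y, δF, D, sA, sdA⟩ with hmA
  have hu0A : ∀ i, |(toModel (canon (framesOK_row 0)) (G 0) (T 0) mA).z (T 0) i| ≤
      (row 0).ubR 0 i := by
    intro i; rw [hmA, z_start_eq _ _ _ y δF D (s' := fun _ => σ₀) (sd' := fun _ => 0) hsA0]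
    exact hu0 i
  have hstA := segment_sound (fun k => row k) (fun k => framesOK_row k) (fun k => G k) T hT mA 657
    (fun k _ => runOK_row k)
    (fun k hk => juncOK_at dflt k (by omega) (not_sw le_rfl (b := 657) hk (by omega)))
    (fun k hk => (hmemA k hk).some) hu0A
  -- ### the stage switch 656|657
  obtain ⟨hok1, henc1, -, hl1⟩ := (runOK_iff _).mp (runOK_row 656)
  have hmem656 : (toModel (canon (framesOK_row 656)) (G 656) (T 656) mA).MemberOn
      (T 656 + (row 656).Hq) := by
    rw [← hT1]; exact (hmemA 656 (by norm_num)).some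
  obtain ⟨ξ₁, hξ₁D, hlock₁, hσ₁, hWD₁, hδw₁, hz₁⟩ := switch_relock swStage_656 (framesOK_row 656)
    hl1 (framesOK_row 657) (G 656) (G 657) ((G_g 657).trans (G_g 656).symm)
    ((G_Λ 657).trans (G_Λ 656).symm) (T 656) mA hok1 henc1 hmem656
    (hstA 656 (by norm_num)).1 hW1
    (fun σ hσ hE => htube 657 (by norm_num) σ hσ (T 657) ⟨le_rfl, hTm (by norm_num)⟩
      (fun a => by rw [sub_self]; exact hE a))
  rw [← hT1] at hσ₁ hWD₁ hδw₁ hz₁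
  -- ### segment B: rows 657 … 973
  have hTB : ∀ k, T (657 + (k + 1)) = T (657 + k) + (row (657 + k)).Hq := fun k => hT (657 + k)
  obtain ⟨sB, sdB, hsB0, hmemB⟩ := segment_members (fun k => row (657 + k))
    (fun k => framesOK_row (657 + k)) (fun k => G (657 + k)) (fun k => T (657 + k)) hTB 317
    (fun k _ => runOK_row (657 + k))
    (fun k hk => juncOK_at dflt (657 + k) (by omega) (not_sw le_rfl (b := 657 + 317) (by omega)
      (by omega)))
    (fun k hk => p_const (k := 657 + k) (by omega) (by omega) (by omega)) hDo
    (fun k _ => hyk (657 + k))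
    (fun k hk => hFck (657 + k) (by omega)) (fun k hk => htube (657 + k) (by omega)) hDmax hξ₁D
    hlock₁ hz₁
  set mB' : MemberData := ⟨y, δF, D, sB, sdB⟩ with hmB'
  have hu0B : ∀ i, |(toModel (canon (framesOK_row 657)) (G 657) (T 657) mB').z (T 657) i| ≤
      (row 657).ubR 0 i := by
    intro i; rw [hmB', z_start_eq _ _ _ y δF D (s' := fun _ => ξ₁) (sd' := fun _ => 0) hsB0]
    exact hz₁ i
  have hstB := segment_sound (fun k => row (657 + k)) (fun k => framesOK_row (657 + k))
    (fun k => G (657 + k)) (fun k => T (657 + k)) hTB mB' 317 (fun k _ => runOK_row (657 + k))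
    (fun k hk => juncOK_at dflt (657 + k) (by omega) (not_sw le_rfl (b := 657 + 317) (by omega)
      (by omega)))
    (fun k hk => (hmemB k hk).some) hu0B
  -- ### the equal-phase switch 973|974
  obtain ⟨hok2, henc2, -, hl2⟩ := (runOK_iff _).mp (runOK_row 973)
  have hmem973 : (toModel (canon (framesOK_row 973)) (G 973) (T 973) mB').MemberOn
      (T 973 + (row 973).Hq) := by
    rw [← hT2]; exact (hmemB 316 (by norm_num)).some
  obtain ⟨hσ₂D, hlock₂, hz₂⟩ := switchEq_relock swEq_973 (framesOK_row 973) hl2 (framesOK_row 974)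
    (G 973) (G 974) (T 973) mB' hok2 henc2 hmem973 (hstB 316 (by norm_num)).1
  rw [← hT2] at hσ₂D hlock₂ hz₂
  have hz₂' : ∀ i, |(toModel (canon (framesOK_row 974)) (G 974) (T 974)
      ⟨y, δF, D, fun _ => sB (T 974), fun _ => 0⟩).z (T 974) i| ≤ (row 974).ubR 0 i := by
    intro i
    rw [← z_start_eq _ _ _ y δF D (s := sB) (sd := sdB) (s' := fun _ => sB (T 974))
      (sd' := fun _ => 0) rfl]
    exact hz₂ i
  -- ### segment C: rows 974 … 986
  have hTC : ∀ k, T (974 + (k + 1)) = T (974 + k) + (row (974 + k)).Hq := fun k => hT (974 + k)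
  obtain ⟨sC, sdC, hsC0, hmemC⟩ := segment_members (fun k => row (974 + k))
    (fun k => framesOK_row (974 + k)) (fun k => G (974 + k)) (fun k => T (974 + k)) hTC 13
    (fun k _ => runOK_row (974 + k))
    (fun k hk => juncOK_at dflt (974 + k) (by omega) (not_sw le_rfl (b := 974 + 13) (by omega)
      (by omega)))
    (fun k hk => p_const (k := 974 + k) (by omega) (by omega) (by omega)) hDo
    (fun k _ => hyk (974 + k))
    (fun k hk => hFck (974 + k) (by omega)) (fun k hk => htube (974 + k) (by omega)) hDmax hσ₂D
    hlock₂ hz₂'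
  -- ### glue B and C at `T 974` into `mB` (rows 657 … 986)
  set sBC : ℝ → ℝ := fun t => if t ≤ T 974 then sB t else sC t with hsBC
  set sdBC : ℝ → ℝ := fun t => if t < T 974 then sdB t else sdC t with hsdBC
  set mB : MemberData := ⟨y, δF, D, sBC, sdBC⟩ with hmB
  have hmemBC : ∀ k < 330, Nonempty ((toModel (canon (framesOK_row (657 + k))) (G (657 + k))
      (T (657 + k)) mB).MemberOn (T (657 + (k + 1)))) := by
    intro k hk
    by_cases hkB : k < 317
    · have hkT : T (657 + (k + 1)) ≤ T 974 := hTm (by omega)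
      exact ⟨(hmemB k hkB).some.congr
        (fun t ht => by
          show (if t ≤ T 974 then sB t else sC t) = sB t; rw [if_pos (ht.2.trans hkT)])
        (fun t ht => by
          show (if t < T 974 then sdB t else sdC t) = sdB t
          rw [if_pos (lt_of_lt_of_le ht.2 hkT)])⟩
    · obtain ⟨j, rfl⟩ : ∃ j, k = 317 + j := ⟨k - 317, by omega⟩
      have hj : j < 13 := by omega
      have hkT : T 974 ≤ T (657 + (317 + j)) := hTm (by omega)
      have h := (hmemC j hj).some
      rw [show 974 + (j + 1) = 657 + (317 + j + 1) from by omega,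
        show 974 + j = 657 + (317 + j) from by omega] at h
      exact ⟨h.congr
        (fun t ht => by
          show (if t ≤ T 974 then sB t else sC t) = sC t
          by_cases ht4 : t ≤ T 974
          · have ht' : t = T 974 := le_antisymm ht4 (hkT.trans ht.1)
            have hsC0' : sC (T 974) = sB (T 974) := hsC0
            rw [if_pos ht4, ht', hsC0']
          · rw [if_neg ht4])
        (fun t ht => by
          show (if t < T 974 then sdB t else sdC t) = sdC t
          rw [if_neg (not_lt.mpr (hkT.trans ht.1))])⟩
  have hsBC0 : sBC (T 657) = ξ₁ := by
    show (if T 657 ≤ T 974 then sB (T 657) else sC (T 657)) = ξ₁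
    rw [if_pos (hTm (by norm_num))]
    exact hsB0
  have hu0BC : ∀ i, |(toModel (canon (framesOK_row 657)) (G 657) (T (657 + 0)) mB).z
      (T (657 + 0)) i| ≤ (row 657).ubR 0 i := by
    intro i
    rw [Nat.add_zero, hmB, z_start_eq _ _ _ y δF D (s' := fun _ => ξ₁) (sd' := fun _ => 0) hsBC0]
    exact hz₁ i
  have hstBC := segBC (fun k => T (657 + k)) hTB mB (fun k hk => (hmemBC k hk).some) hu0BC
  -- ### the stage switch 986|987
  obtain ⟨hok3, henc3, -, hl3⟩ := (runOK_iff _).mp (runOK_row 986)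
  have hmem986 : (toModel (canon (framesOK_row 986)) (G 986) (T 986) mB).MemberOn
      (T 986 + (row 986).Hq) := by
    rw [← hT3]; exact (hmemBC 329 (by norm_num)).some
  obtain ⟨ξ₃, hξ₃D, hlock₃, hσ₃, hWD₃, hδw₃, hz₃⟩ := switch_relock swStage_986 (framesOK_row 986)
    hl3 (framesOK_row 987) (G 986) (G 987) ((G_g 987).trans (G_g 986).symm)
    ((G_Λ 987).trans (G_Λ 986).symm) (T 986) mB hok3 henc3 hmem986
    (hstBC 329 (by norm_num)).1 hW2
    (fun σ hσ hE => htube 987 (by norm_num) σ hσ (T 987) ⟨le_rfl, hTm (by norm_num)⟩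
      (fun a => by rw [sub_self]; exact hE a))
  rw [← hT3] at hσ₃ hWD₃ hδw₃ hz₃
  -- ### segment D: rows 987 … 1065
  have hTD : ∀ k, T (987 + (k + 1)) = T (987 + k) + (row (987 + k)).Hq := fun k => hT (987 + k)
  obtain ⟨sD, sdD, hsD0, hmemD⟩ := segment_members (fun k => row (987 + k))
    (fun k => framesOK_row (987 + k)) (fun k => G (987 + k)) (fun k => T (987 + k)) hTD 79
    (fun k _ => runOK_row (987 + k))
    (fun k hk => juncOK_at dflt (987 + k) (by omega) (not_sw le_rfl (b := 987 + 79) (by omega)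
      (by omega)))
    (fun k hk => p_const (k := 987 + k) (by omega) (by omega) (by omega)) hDo
    (fun k _ => hyk (987 + k))
    (fun k hk => hFck (987 + k) (by omega)) (fun k hk => htube (987 + k) (by omega)) hDmax hξ₃D
    hlock₃ hz₃
  -- ### assembly
  refine ⟨sA, sdA, sBC, sdBC, sD, sdD, hsA0, ?_, ⟨⟨rfl, hWD₁, hδw₁, ?_⟩⟩, ⟨⟨rfl, hWD₃, hδw₃, ?_⟩⟩⟩
  · intro k hk
    by_cases hkA : k < 657
    · rw [mOf_A hkA]; exact hmemA k hkA
    by_cases hkB : k < 987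
    · obtain ⟨j, rfl⟩ : ∃ j, k = 657 + j := ⟨k - 657, by omega⟩
      rw [mOf_B (by omega) hkB]
      exact hmemBC j (by omega)
    · obtain ⟨j, rfl⟩ : ∃ j, k = 987 + j := ⟨k - 987, by omega⟩
      rw [mOf_D (by omega)]
      exact hmemD j (by omega)
  · show |sBC (T 657) - sA (T 657)| ≤ _
    rw [hsBC0]; exact hσ₁
  · show |sD (T 987) - sBC (T 987)| ≤ _
    have h0 : sD (T (987 + 0)) = ξ₃ := hsD0
    rw [Nat.add_zero] at h0
    rw [h0]; exact hσ₃

end RowChain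

end Summit.NavierStokesRegularity.FluidComputer
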